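import Summits.ValiantsHypothesis.ValiantsHypothesis.Theses.SchenstedIndex

/-!
# Crux idea `super-schur-weyl-durfee-sandwich` — first lemmas, typed

Crux stmt-ValiantsHypothesis-16081 (`SchenstedIndex.OneFactorisationBandLimit`, "K1"), round 1, ideator 2.
Everything is stated over the route's slot-level objects, with the same abbreviations (same bodies) as
the strategist's `CensusSketch.lean` (`Slot/SP/indOF/spanN/Sep/windowTop`; re-declared here so that this
file only imports the route file); `K1_iff : OneFactorisationBandLimit ↔ … Sep …` is `Iff.rfl`.

The lever: read the block-cycle operators through the Koszul-SIGNED action of `S_D` on a super tensor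
space `(ℂ^{p|q})^{⊗D}` (Berele–Regev 1987 / Sergeev 1984: the kernel of `ℂ[S_D] → End((ℂ^{p|q})^{⊗D})`
is `⊕_{λ ∉ H(p,q)} I_λ`, `H(p,q)` = partitions with `λ_{p+1} ≤ q`).  The ordinary character of that action
is `χ_{p|q}(τ) = ∏_{cycles c of τ} (p + (-1)^{|c|-1} q)`; its Gram compression to the set-partition module is
`gradedKernel`, whose column space `gradedRange t m p q` is sandwiched
`spanN t m (max p q) ≤ gradedRange t m p q ≤ spanN t m (6 (p + q))`
(lower: ordinary colourings are graded colourings with no odd colour; upper: the graded reading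
polynomial `F_{p|q}(A) = ½[tr A^m + tr(S A^m) − tr((SA)^m) + tr(S (SA)^m)]` lies in `X̄_{6(p+q)}` and the
slot-level expansion of PowTraceCertificate runs verbatim).  Consequences typed below: the SQUARE FLOOR on
K1 witnesses and the DURFEE transfer `C⁺`.
-/

open scoped BigOperators

namespace Summit.ValiantsHypothesis.ValiantsHypothesis.Cruxes.OneFactorisationBandLimit.SuperSandwich

-- summit = sub-problem name (single-conjunct summit, D-0017 layout), so the namespace repeats it
set_option linter.dupNamespace false

open Summit.ValiantsHypothesis.ValiantsHypothesis.Theses.SchenstedIndex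

noncomputable section
open Classical

/-! ## The route's objects, named (verbatim bodies of the strategist's `Census` abbreviations) -/

/-- slots of the sector `t·J_m` -/
abbrev Slot (t m : ℕ) := Fin t × Fin m × Fin m

/-- set partitions of the slots into blocks of size `m` -/
abbrev SP (t m : ℕ) :=
  {π : Finpartition (Finset.univ : Finset (Slot t m)) // ∀ B ∈ π.parts, B.card = m}

/-- the 1-factorisation indicator `1_OF(t,m)` -/
def indOF (t m : ℕ) : SP t m → ℂ := fun π =>
  if (∀ B ∈ π.1.parts, (B.image fun s => s.2.1).card = m ∧ (B.image fun s => s.2.2).card = m)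
  then (1 : ℂ) else 0

/-- the block-cycle vector `v_X` of a slot matrix -/
def blockCycle (t m : ℕ) (X : Matrix (Slot t m) (Slot t m) ℂ) : SP t m → ℂ := fun π =>
  ∏ B ∈ π.1.parts, ∑ q : Fin m ≃ ↥B, ∏ i : Fin m, X (q i).1 (q (finRotate m i)).1

/-- `span_n(t,m)` -/
def spanN (t m n : ℕ) : Submodule ℂ (SP t m → ℂ) :=
  Submodule.span ℂ (Set.range fun X : {X : Matrix (Slot t m) (Slot t m) ℂ // X.rank ≤ n} =>
    blockCycle t m X.1)

/-- separation at `(t,m,n)`: `1_OF(t,m) ∉ span_n(t,m)` -/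
def Sep (t m n : ℕ) : Prop := indOF t m ∉ spanN t m n

/-- the quasi-polynomial window top `N_c(m) = 2^((log₂ m + c)^c)` -/
def windowTop (c m : ℕ) : ℕ := 2 ^ ((Nat.log 2 m + c) ^ c)

/-- K1 in this vocabulary (definitionally the route decl). -/
theorem K1_iff :
    OneFactorisationBandLimit ↔
      ∀ c m₀ : ℕ, ∃ m : ℕ, m₀ ≤ m ∧ 1 ≤ m ∧
        ∀ e : ℕ, m + e ≤ windowTop c m → ∃ t : ℕ, Sep t m (m + e) :=
  Iff.rfl

/-- the permutations "of" a set partition `π`: block-preserving and transitive on every block, i.e. the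
`((m-1)!)^{tm}` permutations whose cycles are exactly the blocks of `π` (the summands of `ξ_π`). -/
def blockPerms {t m : ℕ} (π : SP t m) : Finset (Equiv.Perm (Slot t m)) :=
  Finset.univ.filter fun σ =>
    (∀ B ∈ π.1.parts, ∀ s ∈ B, σ s ∈ B) ∧
      ∀ B ∈ π.1.parts, ∀ s ∈ B, ∀ s' ∈ B, ∃ k : Fin (m + 1), (σ ^ (k : ℕ)) s = s'

/-- number of fixed points of `τ` (cycles of length one, absent from `Equiv.Perm.cycleType`). -/
def fixCard {t m : ℕ} (τ : Equiv.Perm (Slot t m)) : ℕ :=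
  (Finset.univ.filter fun s => τ s = s).card

/-- the ordinary character of the Koszul-signed action of `S_D` on `(ℂ^{p|q})^{⊗ D}`:
`χ_{p|q}(τ) = ∏_{cycles c} (p + (-1)^{|c|-1} q)` (a fixed point contributes `p + q`). -/
def superChar {t m : ℕ} (p q : ℕ) (τ : Equiv.Perm (Slot t m)) : ℂ :=
  ((p : ℂ) + q) ^ fixCard τ * (τ.cycleType.map fun c => (p : ℂ) + (-1 : ℂ) ^ (c - 1) * q).prod

/-- the `(p|q)`-graded Schensted kernel `K_{p|q}(π, π') = Σ_{σ ∼ π, σ' ∼ π'} χ_{p|q}(σ⁻¹ σ')`. -/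
def gradedKernel (t m p q : ℕ) : Matrix (SP t m) (SP t m) ℂ :=
  fun π π' => ∑ σ ∈ blockPerms π, ∑ σ' ∈ blockPerms π', superChar p q (σ⁻¹ * σ')

/-- its column space: the `(p|q)`-graded span ("Durfee span" when `p = q`). -/
def gradedRange (t m p q : ℕ) : Submodule ℂ (SP t m → ℂ) :=
  LinearMap.range (Matrix.toLin' (gradedKernel t m p q))

/-- the ordinary kernel as the `(n|0)` case: `K_n(π,π') = Σ n^{cyc(σ⁻¹σ')}`; its column space is `spanN`
(PSD Gram argument) — recorded as a Prop to be proved by the crux-plan, not assumed anywhere. -/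
def OrdinaryRangeIsSpan : Prop :=
  ∀ t m n : ℕ, gradedRange t m n 0 = spanN t m n

/-- SANDWICH, lower half (easy: an `n`-colouring is a graded colouring using only even colours /
only odd colours). -/
def SandwichLower : Prop :=
  ∀ t m p q : ℕ, spanN t m (max p q) ≤ gradedRange t m p q

/-- SANDWICH, upper half (the graded reading polynomial `F_{p|q}(A(y))` is a border sum of four trace
powers of total width `6(p+q)`, and the slot-level expansion of `PowTraceCertificate` applies). -/
def SandwichUpper : Prop :=
  ∀ t m p q : ℕ, gradedRange t m p q ≤ spanN t m (6 * (p + q))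

/-- SQUARE FLOOR (the headline provable consequence): a width-`n` certificate has all its `S_{tm²}`
ideal-types containing the square `(⌊n/12⌋+1)^{⌊n/12⌋+1}`, so the sector must have at least that many
slots.  Content exactly where the old degree floor `tm ≥ n+1` is silent (`n > 144 m`). -/
def SquareFloor : Prop :=
  ∀ t m n : ℕ, Sep t m n → (n / 12 + 1) ^ 2 ≤ t * m ^ 2

/-- STAIRCASE FLOOR (same mechanism run over all `(p, q)` with `p + q = ⌊n/6⌋`): certificate types
contain the staircase `(s+1, s, …, 1)`, `s = ⌊n/6⌋`. -/
def StaircaseFloor : Prop :=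
  ∀ t m n : ℕ, Sep t m n → (n / 6 + 1) * (n / 6 + 2) ≤ 2 * (t * m ^ 2)

/-- the TRANSFER `C⁺` ("Durfee band-limit"): the 1-factorisation indicator escapes the `(n|n)`-graded
span — whose kernel is the all-odd-cycle kernel `(2n)^{cyc(σ⁻¹σ')}·[σ⁻¹σ' has only odd cycles]` and whose
certificate ideal-types are exactly the partitions containing an `(n+1) × (n+1)` square. -/
def DurfeeBandLimit : Prop :=
  ∀ c m₀ : ℕ, ∃ m : ℕ, m₀ ≤ m ∧ 1 ≤ m ∧
    ∀ e : ℕ, m + e ≤ windowTop c m → ∃ t : ℕ, indOF t m ∉ gradedRange t m (m + e) (m + e)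

/-- `C⁺ ⇒ K1` given the easy half of the sandwich (kernel-checked plumbing). -/
theorem K1_of_durfee (hS : SandwichLower) (hD : DurfeeBandLimit) : OneFactorisationBandLimit := by
  intro c m₀
  obtain ⟨m, hm₀, hm1, hw⟩ := hD c m₀
  refine ⟨m, hm₀, hm1, fun e he => ?_⟩
  obtain ⟨t, ht⟩ := hw e he
  refine ⟨t, fun hmem => ht ?_⟩
  have hle : spanN t m (m + e) ≤ gradedRange t m (m + e) (m + e) := by
    simpa using hS t m (m + e) (m + e)
  exact hle hmem

/-- and K1 at width `6·2·n` gives `C⁺` at width `n` back (the sandwich's upper half), so `C⁺` and K1 agree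
up to the constant 12 in the width — absorbed by the quasi-polynomial window.  Typed as the
pointwise statement the crux-plan would prove: -/
def DurfeeOfSepScaled : Prop :=
  ∀ t m n : ℕ, Sep t m (12 * n) → indOF t m ∉ gradedRange t m n n

theorem durfeeOfSepScaled_of_upper (hU : SandwichUpper) : DurfeeOfSepScaled := by
  intro t m n hs hmem
  apply hs
  have hle : gradedRange t m n n ≤ spanN t m (6 * (n + n)) := hU t m n n
  have h12 : 6 * (n + n) = 12 * n := by ring
  rw [h12] at hle
  exact hle hmem

end

end Summit.ValiantsHypothesis.ValiantsHypothesis.Cruxes.OneFactorisationBandLimit.SuperSandwich
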